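import Mathlib.Analysis.InnerProductSpace.PiL2
import Mathlib.Analysis.InnerProductSpace.Projection.FiniteDimensional

/-!
# Transfer of a configuration lying in an `n`-dimensional subspace of `ℝᵐ` to `ℝⁿ`

Framing: lottery ticket; floor = certified bounds/negative ranges. Venture `PackingBounds` (cell
`pub-packcert`, seat `pub-packcert-energy`), attained side: several optimal configurations are most
naturally written with integer coordinates in a bigger space — the `56`-point and `27`-point sharp
configurations as sections of the `E₈` root system inside `ℝ⁸`, the regular simplex inside `ℝⁿ⁺¹`,
the Higman–Sims / McLaughlin / `552`-point configurations as sections of the Leech lattice inside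
`ℝ²⁴`. This file moves such a finite configuration `C ⊆ V`, `V` a subspace of `ℝᵐ` with
`finrank V = n`, to `ℝⁿ` keeping its cardinality, norms, pairwise inner products and hence every
energy `Σ_{x ≠ y} a(⟪x,y⟫)` (`exists_transfer`); `exists_transfer_orthogonal_singleton` is the
codimension-one case `V = (ℝ u)ᗮ`.
-/

namespace Summit.Ventures.PackingBounds.Config

open Finset Module

/-- An `n`-dimensional subspace of `ℝᵐ` maps to `ℝⁿ` preserving inner products. -/
theorem exists_inner_preserving {m n : ℕ} (V : Submodule ℝ (EuclideanSpace ℝ (Fin m)))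
    (hV : finrank ℝ V = n) :
    ∃ f : EuclideanSpace ℝ (Fin m) → EuclideanSpace ℝ (Fin n),
      ∀ x ∈ V, ∀ y ∈ V, inner ℝ (f x) (f y) = inner ℝ x y := by
  classical
  let b : OrthonormalBasis (Fin n) ℝ V := (stdOrthonormalBasis ℝ V).reindex (finCongr hV)
  refine ⟨fun x => if h : x ∈ V then b.repr ⟨x, h⟩ else 0, fun x hx y hy => ?_⟩
  simp only [dif_pos hx, dif_pos hy, LinearIsometryEquiv.inner_map_map, Submodule.coe_inner]

/-- A map preserving inner products on `V` is injective on `V`. -/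
theorem injOn_of_inner_preserving {m n : ℕ} {V : Submodule ℝ (EuclideanSpace ℝ (Fin m))}
    {f : EuclideanSpace ℝ (Fin m) → EuclideanSpace ℝ (Fin n)}
    (hf : ∀ x ∈ V, ∀ y ∈ V, inner ℝ (f x) (f y) = inner ℝ x y) :
    Set.InjOn f V := by
  intro x hx y hy hxy
  have h : ‖x - y‖ ^ 2 = ‖f x - f y‖ ^ 2 := by
    rw [@norm_sub_sq ℝ, @norm_sub_sq ℝ, ← real_inner_self_eq_norm_sq, ← real_inner_self_eq_norm_sq,
      ← real_inner_self_eq_norm_sq, ← real_inner_self_eq_norm_sq, hf x hx x hx, hf y hy y hy,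
      hf x hx y hy]
  rw [hxy, sub_self, norm_zero] at h
  have h0 : ‖x - y‖ = 0 := by nlinarith [norm_nonneg (x - y)]
  rwa [norm_eq_zero, sub_eq_zero] at h0

/-- **Transfer.** A finite configuration inside a subspace `V ⊆ ℝᵐ` with `finrank V = n` has a copy in
`ℝⁿ` with the same cardinality, the same norms, the same pairwise inner products and the same
`a`-energy for every potential `a`. -/
theorem exists_transfer {m n : ℕ} (V : Submodule ℝ (EuclideanSpace ℝ (Fin m)))
    (hV : finrank ℝ V = n) (C : Finset (EuclideanSpace ℝ (Fin m))) (hC : ∀ x ∈ C, x ∈ V) :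
    ∃ C' : Finset (EuclideanSpace ℝ (Fin n)), C'.card = C.card ∧
      (∀ x' ∈ C', ∃ x ∈ C, ‖x'‖ = ‖x‖) ∧
      (∀ x' ∈ C', ∀ y' ∈ C', x' ≠ y' → ∃ x ∈ C, ∃ y ∈ C, x ≠ y ∧ inner ℝ x' y' = inner ℝ x y) ∧
      ∀ a : ℝ → ℝ, ∑ x' ∈ C', ∑ y' ∈ C'.erase x', a (inner ℝ x' y') =
        ∑ x ∈ C, ∑ y ∈ C.erase x, a (inner ℝ x y) := by
  classical
  obtain ⟨f, hf⟩ := exists_inner_preserving V hV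
  have hinj : Set.InjOn f C := fun x hx y hy h =>
    injOn_of_inner_preserving hf (hC x hx) (hC y hy) h
  refine ⟨C.image f, Finset.card_image_of_injOn hinj, ?_, ?_, ?_⟩
  · intro x' hx'
    obtain ⟨x, hx, rfl⟩ := Finset.mem_image.1 hx'
    refine ⟨x, hx, ?_⟩
    have h := hf x (hC x hx) x (hC x hx)
    rw [real_inner_self_eq_norm_sq, real_inner_self_eq_norm_sq] at h
    nlinarith [norm_nonneg (f x), norm_nonneg x]
  · intro x' hx' y' hy' hne
    obtain ⟨x, hx, rfl⟩ := Finset.mem_image.1 hx'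
    obtain ⟨y, hy, rfl⟩ := Finset.mem_image.1 hy'
    exact ⟨x, hx, y, hy, fun h => hne (by rw [h]), hf x (hC x hx) y (hC y hy)⟩
  · intro a
    rw [Finset.sum_image hinj]
    refine Finset.sum_congr rfl fun x hx => ?_
    have he : (C.image f).erase (f x) = (C.erase x).image f := by
      ext y'
      simp only [Finset.mem_erase, Finset.mem_image]
      constructor
      · rintro ⟨hne, y, hy, rfl⟩
        exact ⟨y, ⟨fun h => hne (by rw [h]), hy⟩, rfl⟩
      · rintro ⟨y, ⟨hne, hy⟩, rfl⟩
        exact ⟨fun h => hne (hinj hy hx h), y, hy, rfl⟩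
    rw [he, Finset.sum_image fun y hy z hz h =>
      hinj (Finset.mem_of_mem_erase hy) (Finset.mem_of_mem_erase hz) h]
    exact Finset.sum_congr rfl fun y hy => by rw [hf x (hC x hx) y (hC y (Finset.mem_of_mem_erase hy))]

/-- **Codimension one.** A finite configuration of `ℝ^{n+1}` orthogonal to a nonzero vector `u` has
a copy in `ℝⁿ` with the same cardinality, norms, pairwise inner products and energies. -/
theorem exists_transfer_orthogonal_singleton {n : ℕ} (u : EuclideanSpace ℝ (Fin (n + 1)))
    (hu : u ≠ 0) (C : Finset (EuclideanSpace ℝ (Fin (n + 1)))) (hC : ∀ x ∈ C, inner ℝ u x = 0) :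
    ∃ C' : Finset (EuclideanSpace ℝ (Fin n)), C'.card = C.card ∧
      (∀ x' ∈ C', ∃ x ∈ C, ‖x'‖ = ‖x‖) ∧
      (∀ x' ∈ C', ∀ y' ∈ C', x' ≠ y' → ∃ x ∈ C, ∃ y ∈ C, x ≠ y ∧ inner ℝ x' y' = inner ℝ x y) ∧
      ∀ a : ℝ → ℝ, ∑ x' ∈ C', ∑ y' ∈ C'.erase x', a (inner ℝ x' y') =
        ∑ x ∈ C, ∑ y ∈ C.erase x, a (inner ℝ x y) := by
  haveI : Fact (finrank ℝ (EuclideanSpace ℝ (Fin (n + 1))) = n + 1) := ⟨finrank_euclideanSpace_fin⟩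
  refine exists_transfer (ℝ ∙ u)ᗮ (Submodule.finrank_orthogonal_span_singleton hu) C fun x hx => ?_
  rw [Submodule.mem_orthogonal_singleton_iff_inner_right]
  exact hC x hx

/-- **Codimension `k` by orthogonality.** A finite configuration of `ℝᵐ` orthogonal to `k` linearly
independent vectors `u₀, …, u_{k-1}` with `m = n + k` has a copy in `ℝⁿ` with the same cardinality,
norms, pairwise inner products and energies. -/
theorem exists_transfer_orthogonal {m n k : ℕ} (hm : m = n + k) (u : Fin k → EuclideanSpace ℝ (Fin m))
    (hu : LinearIndependent ℝ u) (C : Finset (EuclideanSpace ℝ (Fin m)))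
    (hC : ∀ x ∈ C, ∀ i, inner ℝ (u i) x = 0) :
    ∃ C' : Finset (EuclideanSpace ℝ (Fin n)), C'.card = C.card ∧
      (∀ x' ∈ C', ∃ x ∈ C, ‖x'‖ = ‖x‖) ∧
      (∀ x' ∈ C', ∀ y' ∈ C', x' ≠ y' → ∃ x ∈ C, ∃ y ∈ C, x ≠ y ∧ inner ℝ x' y' = inner ℝ x y) ∧
      ∀ a : ℝ → ℝ, ∑ x' ∈ C', ∑ y' ∈ C'.erase x', a (inner ℝ x' y') =
        ∑ x ∈ C, ∑ y ∈ C.erase x, a (inner ℝ x y) := by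
  set K : Submodule ℝ (EuclideanSpace ℝ (Fin m)) := Submodule.span ℝ (Set.range u) with hK
  have hKr : finrank ℝ K = k := by
    rw [hK, finrank_span_eq_card hu, Fintype.card_fin]
  have hV : finrank ℝ Kᗮ = n := by
    have h := Submodule.finrank_add_finrank_orthogonal K
    rw [hKr, finrank_euclideanSpace_fin] at h
    omega
  refine exists_transfer Kᗮ hV C fun x hx => ?_
  rw [hK, Submodule.mem_orthogonal]
  intro v hv
  refine Submodule.span_induction (fun w ⟨i, hi⟩ => hi ▸ hC x hx i) (inner_zero_left _)
    (fun v w _ _ h1 h2 => by rw [inner_add_left, h1, h2, add_zero])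
    (fun c v _ h => by rw [real_inner_smul_left, h, mul_zero]) hv

end Summit.Ventures.PackingBounds.Config
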